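import Literature.Analysis.ODE.AprioriTwoSided
import Literature.MathematicalPhysics.KineticTheory.InfiniteChainDynamicsProofs
import Literature.MathematicalPhysics.KineticTheory.LangevinChainSDE
import HarnessLib

/-!
# Global existence of the severed chain dynamics: LLL's condition B1 for potentials bounded below

Topic `Literature/MathematicalPhysics/KineticTheory`; second proofs companion of
`InfiniteChainDynamics.lean` (after `InfiniteChainDynamicsProofs.lean`, LLL Thm 1, whose severed
phase space `sevGlue`/`sevField` and `contDiff_sevField` are reused here), for the file's named
predicate `OscillatorChain.CondB1`, which vendors Lanford–Lebowitz–Lieb's condition **B1**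
(J. Stat. Phys. **16** (1977) 453–461, §4, p. 459) as the predicate
`OscillatorChain.CondB1 P`: for every finite `Λ ⊂ ℤ` and every initial configuration the
*severed* equations of motion (9a)–(9c) — particles in `Λ` move under the full force, particles
outside `Λ` are tied down — have a solution defined for all times.

In the source B1 is an ASSUMPTION (of Theorems 3–4), not a result; it depends on the chain data and
its universal closure `∀ P, P.CondB1` is false (`InfiniteChainDynamicsBlowup.lean`:
`U(q) = -q⁴/2` blows up in finite time). What CAN be discharged is the classical sufficient
condition, which is what LLL use in the proof of their Theorem 1 (p. 456): "The time evolution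
mappings `T_t^α` generated by (9a)–(9c) leave invariant the energy in `Λ_α`,
`H_α(q, p) = ∑_{i∈Λ_α} [½ p_i² + U_i(q_i)] + ∑'_j V_j(q)`" (the primed sum over the bonds meeting
`Λ_α`), so that "solutions of (9a)–(9c) are prevented from going to infinity in finite time …; they
therefore exist for all time". This file proves:

**`OscillatorChain.condB1_of_bddBelow`**: if `U, V ∈ C²` (LLL's A2) and `U`, `V` are bounded
below, then `P.CondB1`; and its instance **`condB1_pinnedChain`** for the pinned anharmonic chain
`U = ω₂q²/2 + lam q⁴/4`, `V = r²/2 + β r⁴/4` (`ω₂, lam, β ≥ 0`) of the requesting statement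
(`FouriersLaw.pinnedChain`).

## Proof architecture

* The severed system for `(Λ, σ)` is the autonomous ODE `x' = F(x)` on the finite-dimensional space
  `↥Λ → ℝ × ℝ` of moving coordinates, `F(x)_i = (p_i, F_i(glue σ x))` (`sevField`,
  `InfiniteChainDynamicsProofs.lean`), where `sevGlue Λ σ x : ℤ → ℝ × ℝ` inserts `x` into the
  frozen configuration `σ`. `F` is `C¹` (`contDiff_sevField`), hence Lipschitz on balls
  (`exists_lipschitzOnWith_closedBall`). Unlike the proof of Thm 1 (cut-off flows + Lemma 1 under
  A3–A4) no cut-off is used here: the energy bound feeds the continuation principle directly.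
* The severed energy `H_Λ = ∑_{i∈Λ} (½ p_i² + U(q_i) - m_U) + ∑_{j : j ∈ Λ ∨ j+1 ∈ Λ} (V(q_{j+1} - q_j) - m_V)`
  (`sevEnergy`, shifted by the lower bounds so that every term is `≥ 0`) has zero derivative along
  every solution of `x' = c • F(x)` (`hasDerivWithinAt_sevEnergy`; the bond sum telescopes against
  `∑_i p_i R_i`, `sevBonds_telescope`), for any real `c` (time reversal included).
* Hence `|p_i(t)| ≤ M := (2 H_Λ(x₀))^{1/2}` and, by the mean value inequality, `|q_i(t) - q_i(0)| ≤ M T`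
  on `[0, s] ⊆ [0, T]`: the a priori bound `‖x(t)‖ ≤ ‖x₀‖ + M (T + 1)` (`norm_le_of_sevSolution`).
* The tree's continuation principle in a-priori-bound form
  (`Literature.Analysis.ODE.exists_solution_real_of_apriori_bound`, from Teschl 2012 Cor. 2.16)
  gives a solution on all of `ℝ` (`exists_sevSolution`); gluing it into `σ` is a severed solution
  in the sense of `IsSeveredSolution` (`condB1_of_bddBelow`).

## References

* O. E. Lanford III, J. L. Lebowitz, E. H. Lieb, *Time evolution of infinite anharmonic systems*,
  J. Stat. Phys. 16 (1977) 453–461: §2 eqs. (9a)–(9c) and the energy `H_α` (10) in the proof of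
  Thm 1 (p. 456); §4 condition B1 (p. 459). [LanfordLebowitzLieb1977]
* G. Teschl, *Ordinary Differential Equations and Dynamical Systems* (AMS 2012), Cor. 2.16. [Teschl2012]
-/

noncomputable section

open Set Metric Filter Topology

open scoped NNReal ContDiff

namespace Literature.MathematicalPhysics.KineticTheory.HeatConduction

namespace OscillatorChain

variable (P : OscillatorChain) (Λ : Finset ℤ) (σ : ChainConfig)

/-! ### The severed system as an ODE on `↥Λ → ℝ × ℝ` -/

/-- The velocity of site `j` in the severed dynamics: `p_j` for `j ∈ Λ`, `0` for the tied-down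
sites. [cite: LanfordLebowitzLieb1977, §2 eqs. (9a)–(9c)] -/
def sevVel (Λ : Finset ℤ) (x : ↥Λ → ℝ × ℝ) (j : ℤ) : ℝ := if h : j ∈ Λ then (x ⟨j, h⟩).2 else 0

/-- The bonds `(j, j+1)` meeting `Λ`, labelled by their left endpoint `j`: `j ∈ Λ` or `j + 1 ∈ Λ`
(LLL's primed sum "over all `j` such that `dist(j, Λ) ≤ D`", `D = 1`). [cite: LanfordLebowitzLieb1977, §2 eq. (10)] -/
def sevBonds (Λ : Finset ℤ) : Finset ℤ := Λ ∪ Λ.image (fun i => i - 1)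

/-- The severed energy `H_Λ(q, p) = ∑_{i∈Λ} (½ p_i² + U(q_i)) + ∑'_j V(q_{j+1} - q_j)` of LLL
(proof of Thm 1, p. 456), with each term shifted by a lower bound (`m_U` of `U`, `m_V` of `V`) so
that all terms are nonnegative when `m_U ≤ U`, `m_V ≤ V`. [cite: LanfordLebowitzLieb1977, §2 proof of Thm 1] -/
def sevEnergy (mU mV : ℝ) (x : ↥Λ → ℝ × ℝ) : ℝ :=
  (∑ i ∈ Λ, (sevVel Λ x i ^ 2 / 2 + (P.U (sevGlue Λ σ x i).1 - mU))) +
    ∑ j ∈ sevBonds Λ, (P.V ((sevGlue Λ σ x (j + 1)).1 - (sevGlue Λ σ x j).1) - mV)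

/-! ### Conservation of the severed energy -/

/-- **Telescoping of the bond sum.** For velocities `v` vanishing off `Λ`,
`∑_{bonds j} a_j (v_{j+1} - v_j) = ∑_{i∈Λ} v_i (a_{i-1} - a_i)` — the identity behind
`dH_Λ/dt = 0` (the work of the bond forces against `∑_i p_i R_i`). [folklore] -/
theorem sevBonds_telescope (a v : ℤ → ℝ) (hv : ∀ j ∉ Λ, v j = 0) :
    ∑ j ∈ sevBonds Λ, a j * (v (j + 1) - v j) = ∑ i ∈ Λ, v i * (a (i - 1) - a i) := by
  have hΛB : Λ ⊆ sevBonds Λ := Finset.subset_union_left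
  have hIB : Λ.image (fun i => i - 1) ⊆ sevBonds Λ := Finset.subset_union_right
  have h1 : ∑ j ∈ sevBonds Λ, a j * v (j + 1) = ∑ i ∈ Λ, a (i - 1) * v i := by
    rw [← Finset.sum_subset hIB]
    · rw [Finset.sum_image]
      · exact Finset.sum_congr rfl fun i _ => by rw [sub_add_cancel]
      · intro x _ y _ h
        simpa using h
    · intro j _ hj
      have : j + 1 ∉ Λ := fun h => hj (Finset.mem_image.2 ⟨j + 1, h, by ring⟩)
      rw [hv _ this, mul_zero]
  have h2 : ∑ j ∈ sevBonds Λ, a j * v j = ∑ i ∈ Λ, a i * v i := by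
    rw [← Finset.sum_subset hΛB]
    intro j _ hj
    rw [hv _ hj, mul_zero]
  calc ∑ j ∈ sevBonds Λ, a j * (v (j + 1) - v j)
      = ∑ j ∈ sevBonds Λ, a j * v (j + 1) - ∑ j ∈ sevBonds Λ, a j * v j := by
        rw [← Finset.sum_sub_distrib]
        exact Finset.sum_congr rfl fun j _ => by ring
    _ = ∑ i ∈ Λ, a (i - 1) * v i - ∑ i ∈ Λ, a i * v i := by rw [h1, h2]
    _ = ∑ i ∈ Λ, v i * (a (i - 1) - a i) := by
        rw [← Finset.sum_sub_distrib]
        exact Finset.sum_congr rfl fun j _ => by ring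

/-- First component of a derivative in `ℝ × ℝ` (within a set). [folklore] -/
theorem hasDerivWithinAt_fst_comp {f : ℝ → ℝ × ℝ} {f' : ℝ × ℝ} {s : Set ℝ} {t : ℝ}
    (h : HasDerivWithinAt f f' s t) : HasDerivWithinAt (fun τ => (f τ).1) f'.1 s t := by
  simpa [Function.comp_def] using
    (ContinuousLinearMap.fst ℝ ℝ ℝ).hasFDerivAt.comp_hasDerivWithinAt t h

/-- Second component of a derivative in `ℝ × ℝ` (within a set). [folklore] -/
theorem hasDerivWithinAt_snd_comp {f : ℝ → ℝ × ℝ} {f' : ℝ × ℝ} {s : Set ℝ} {t : ℝ}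
    (h : HasDerivWithinAt f f' s t) : HasDerivWithinAt (fun τ => (f τ).2) f'.2 s t := by
  simpa [Function.comp_def] using
    (ContinuousLinearMap.snd ℝ ℝ ℝ).hasFDerivAt.comp_hasDerivWithinAt t h

/-- **Conservation of the severed energy** (LLL 1977, proof of Thm 1, p. 456: the severed flows
"leave invariant the energy in `Λ_α`"): along any solution of `α' = c • F(α)` (the severed field
scaled by a real constant `c`, so that the time-reversed system `c = -1` is included) the
derivative of `H_Λ(α(t))` vanishes, for `U, V` differentiable. [cite: LanfordLebowitzLieb1977, §2 proof of Thm 1] -/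
theorem hasDerivWithinAt_sevEnergy (hU : Differentiable ℝ P.U) (hV : Differentiable ℝ P.V)
    (mU mV c : ℝ) {α : ℝ → ↥Λ → ℝ × ℝ} {s : Set ℝ} {t : ℝ}
    (hα : HasDerivWithinAt α (c • sevField P Λ σ (α t)) s t) :
    HasDerivWithinAt (fun τ => sevEnergy P Λ σ mU mV (α τ)) 0 s t := by
  have hαi : ∀ i : ↥Λ, HasDerivWithinAt (fun τ => α τ i)
      (c * (α t i).2, c * P.force (sevGlue Λ σ (α t)) i) s t := fun i => by
    have := hasDerivWithinAt_pi.1 hα i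
    simpa [sevField] using this
  -- positions of all sites (frozen outside `Λ`)
  have hq : ∀ j : ℤ, HasDerivWithinAt (fun τ => (sevGlue Λ σ (α τ) j).1)
      (c * sevVel Λ (α t) j) s t := fun j => by
    by_cases h : j ∈ Λ
    · simp_rw [sevGlue_apply_of_mem Λ σ _ h, sevVel, dif_pos h]
      exact hasDerivWithinAt_fst_comp (hαi ⟨j, h⟩)
    · simp_rw [sevGlue_apply_of_not_mem Λ σ _ h, sevVel, dif_neg h, mul_zero]
      exact hasDerivWithinAt_const t s (σ j).1
  -- momenta of the sites of `Λ`
  have hp : ∀ j (h : j ∈ Λ), HasDerivWithinAt (fun τ => sevVel Λ (α τ) j)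
      (c * P.force (sevGlue Λ σ (α t)) j) s t := fun j h => by
    simp_rw [sevVel, dif_pos h]
    exact hasDerivWithinAt_snd_comp (hαi ⟨j, h⟩)
  have hsite : HasDerivWithinAt
      (fun τ => ∑ i ∈ Λ, (sevVel Λ (α τ) i ^ 2 / 2 + (P.U (sevGlue Λ σ (α τ) i).1 - mU)))
      (∑ i ∈ Λ, c * (sevVel Λ (α t) i * (P.force (sevGlue Λ σ (α t)) i +
        deriv P.U (sevGlue Λ σ (α t) i).1))) s t := by
    refine HasDerivWithinAt.fun_sum fun i hi => ?_
    have h1 := ((hp i hi).fun_pow 2).div_const 2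
    have h2 := ((hU _).hasDerivAt.comp_hasDerivWithinAt t (hq i)).sub_const mU
    refine (h1.add h2).congr_deriv ?_
    simp only [Nat.cast_ofNat, Nat.add_one_sub_one, pow_one]
    ring
  have hbond : HasDerivWithinAt
      (fun τ => ∑ j ∈ sevBonds Λ,
        (P.V ((sevGlue Λ σ (α τ) (j + 1)).1 - (sevGlue Λ σ (α τ) j).1) - mV))
      (∑ j ∈ sevBonds Λ, c * (deriv P.V ((sevGlue Λ σ (α t) (j + 1)).1 - (sevGlue Λ σ (α t) j).1) *
        (sevVel Λ (α t) (j + 1) - sevVel Λ (α t) j))) s t := by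
    refine HasDerivWithinAt.fun_sum fun j _ => ?_
    have h := ((hV _).hasDerivAt.comp_hasDerivWithinAt t ((hq (j + 1)).sub (hq j))).sub_const mV
    refine h.congr_deriv ?_
    simp only [Pi.sub_apply]
    ring
  simp only [sevEnergy]
  refine (hsite.add hbond).congr_deriv ?_
  rw [← Finset.mul_sum, ← Finset.mul_sum, ← mul_add]
  have htel := sevBonds_telescope Λ
    (fun j => deriv P.V ((sevGlue Λ σ (α t) (j + 1)).1 - (sevGlue Λ σ (α t) j).1))
    (sevVel Λ (α t)) (fun j hj => by simp [sevVel, hj])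
  rw [htel, ← Finset.sum_add_distrib]
  suffices h : ∑ i ∈ Λ, (sevVel Λ (α t) i * (P.force (sevGlue Λ σ (α t)) i +
      deriv P.U (sevGlue Λ σ (α t) i).1) + sevVel Λ (α t) i *
      ((fun j => deriv P.V ((sevGlue Λ σ (α t) (j + 1)).1 - (sevGlue Λ σ (α t) j).1)) (i - 1) -
        (fun j => deriv P.V ((sevGlue Λ σ (α t) (j + 1)).1 - (sevGlue Λ σ (α t) j).1)) i)) = 0 by
    rw [h, mul_zero]
  refine Finset.sum_eq_zero fun i _ => ?_
  simp only [force_eq, sub_add_cancel]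
  ring

/-! ### The a priori bound and global existence -/

/-- Each kinetic term is dominated by the (shifted, nonnegative) severed energy:
`½ p_i² ≤ H_Λ` for `i ∈ Λ` when `m_U ≤ U` and `m_V ≤ V`. [folklore] -/
theorem sq_sevVel_le {mU mV : ℝ} (hmU : ∀ q, mU ≤ P.U q) (hmV : ∀ r, mV ≤ P.V r)
    (x : ↥Λ → ℝ × ℝ) {i : ℤ} (hi : i ∈ Λ) :
    sevVel Λ x i ^ 2 / 2 ≤ sevEnergy P Λ σ mU mV x := by
  unfold sevEnergy
  have h2 : sevVel Λ x i ^ 2 / 2 + (P.U (sevGlue Λ σ x i).1 - mU) ≤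
      ∑ i ∈ Λ, (sevVel Λ x i ^ 2 / 2 + (P.U (sevGlue Λ σ x i).1 - mU)) :=
    Finset.single_le_sum (f := fun i => sevVel Λ x i ^ 2 / 2 + (P.U (sevGlue Λ σ x i).1 - mU))
      (fun j _ => add_nonneg (by positivity) (sub_nonneg.2 (hmU _))) hi
  have h3 : 0 ≤ ∑ j ∈ sevBonds Λ, (P.V ((sevGlue Λ σ x (j + 1)).1 - (sevGlue Λ σ x j).1) - mV) :=
    Finset.sum_nonneg fun j _ => sub_nonneg.2 (hmV _)
  have h1 : 0 ≤ P.U (sevGlue Λ σ x i).1 - mU := sub_nonneg.2 (hmU _)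
  linarith

/-- **A priori bound for severed solutions** ("solutions of (9a)–(9c) are prevented from going
to infinity in finite time", LLL p. 456): if `U ≥ m_U`, `V ≥ m_V` are differentiable and `|c| ≤ 1`,
every solution of `α' = c • F(α)` on `[0, s] ⊆ [0, T]` with `α 0 = x₀` satisfies
`‖α t‖ ≤ ‖x₀‖ + (2 H_Λ(x₀))^{1/2} (T + 1)` on `[0, s]` (energy conservation bounds the momenta
by `M = (2H_Λ(x₀))^{1/2}`, the mean value inequality then bounds the displacements by `M T`;
sup norm on `↥Λ → ℝ × ℝ`). [cite: LanfordLebowitzLieb1977, §2 proof of Thm 1] -/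
theorem norm_le_of_sevSolution (hU : Differentiable ℝ P.U) (hV : Differentiable ℝ P.V)
    {mU mV : ℝ} (hmU : ∀ q, mU ≤ P.U q) (hmV : ∀ r, mV ≤ P.V r) {c : ℝ} (hc : |c| ≤ 1)
    {x₀ : ↥Λ → ℝ × ℝ} {s T : ℝ} (hsT : s ≤ T) {α : ℝ → ↥Λ → ℝ × ℝ} (hα0 : α 0 = x₀)
    (hα : ∀ t ∈ Icc 0 s, HasDerivWithinAt α (c • sevField P Λ σ (α t)) (Icc 0 s) t) :
    ∀ t ∈ Icc 0 s, ‖α t‖ ≤ ‖x₀‖ + Real.sqrt (2 * sevEnergy P Λ σ mU mV x₀) * (T + 1) := by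
  intro t ht
  set M := Real.sqrt (2 * sevEnergy P Λ σ mU mV x₀) with hM
  have hM0 : 0 ≤ M := Real.sqrt_nonneg _
  have hT : 0 ≤ T := ht.1.trans (ht.2.trans hsT)
  -- conservation of the severed energy
  have hE : ∀ τ ∈ Icc 0 s, sevEnergy P Λ σ mU mV (α τ) = sevEnergy P Λ σ mU mV x₀ := by
    intro τ hτ
    have h := (convex_Icc 0 s).norm_image_sub_le_of_norm_hasDerivWithin_le
      (f := fun τ => sevEnergy P Λ σ mU mV (α τ)) (f' := fun _ => 0) (C := 0)
      (fun u hu => hasDerivWithinAt_sevEnergy P Λ σ hU hV mU mV c (hα u hu)) (fun _ _ => by simp)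
      (left_mem_Icc.2 (hτ.1.trans hτ.2)) hτ
    rw [zero_mul, norm_le_zero_iff, sub_eq_zero] at h
    rw [h, hα0]
  -- momenta are bounded by `M`
  have hp : ∀ τ ∈ Icc 0 s, ∀ i : ↥Λ, |(α τ i).2| ≤ M := by
    intro τ hτ i
    have h1 := sq_sevVel_le P Λ σ hmU hmV (α τ) i.2
    rw [hE τ hτ] at h1
    have h2 : sevVel Λ (α τ) i = (α τ i).2 := by simp [sevVel]
    rw [h2] at h1
    exact Real.abs_le_sqrt (by linarith)
  -- positions move at speed at most `M`
  have hq : ∀ i : ↥Λ, |(α t i).1 - (x₀ i).1| ≤ M * T := by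
    intro i
    have hd : ∀ τ ∈ Icc 0 s, HasDerivWithinAt (fun τ => (α τ i).1) (c * (α τ i).2) (Icc 0 s) τ := by
      intro τ hτ
      have := hasDerivWithinAt_pi.1 (hα τ hτ) i
      exact hasDerivWithinAt_fst_comp (by simpa [sevField] using this)
    have h := (convex_Icc 0 s).norm_image_sub_le_of_norm_hasDerivWithin_le (C := M) hd
      (fun τ hτ => ?_) (left_mem_Icc.2 (ht.1.trans ht.2)) ht
    · rw [hα0, Real.norm_eq_abs, sub_zero, Real.norm_eq_abs, abs_of_nonneg ht.1] at h
      refine h.trans ?_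
      exact mul_le_mul_of_nonneg_left (ht.2.trans hsT) hM0
    · rw [Real.norm_eq_abs, abs_mul]
      calc |c| * |(α τ i).2| ≤ 1 * M := mul_le_mul hc (hp τ hτ i) (abs_nonneg _) zero_le_one
        _ = M := one_mul M
  have hR0 : 0 ≤ ‖x₀‖ + M * (T + 1) := by positivity
  rw [pi_norm_le_iff_of_nonneg hR0]
  intro i
  have hx : |(x₀ i).1| ≤ ‖x₀‖ := by
    have h1 := norm_le_pi_norm x₀ i
    have h2 := norm_fst_le (x₀ i)
    rw [Real.norm_eq_abs] at h2
    exact h2.trans h1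
  rw [Prod.norm_def, max_le_iff, Real.norm_eq_abs, Real.norm_eq_abs]
  constructor
  · have := abs_sub_abs_le_abs_sub (α t i).1 (x₀ i).1
    nlinarith [hq i, norm_nonneg x₀]
  · nlinarith [hp t ht i, norm_nonneg x₀]

/-- **Global existence of the severed dynamics** for `U, V ∈ C²` bounded below: from every
initial point the ODE `x' = F(x)` on `↥Λ → ℝ × ℝ` has a solution defined on all of `ℝ`
(the a priori bound `norm_le_of_sevSolution` for `c = ±1` fed into the continuation principle
`Literature.Analysis.ODE.exists_solution_real_of_apriori_bound`; `F` is `C¹`, hence Lipschitz on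
balls). [cite: LanfordLebowitzLieb1977, §2 proof of Thm 1] -/
theorem exists_sevSolution (hU : ContDiff ℝ 2 P.U) (hV : ContDiff ℝ 2 P.V)
    (hUb : BddBelow (Set.range P.U)) (hVb : BddBelow (Set.range P.V)) (x₀ : ↥Λ → ℝ × ℝ) :
    ∃ α : ℝ → ↥Λ → ℝ × ℝ, α 0 = x₀ ∧ ∀ t, HasDerivAt α (sevField P Λ σ (α t)) t := by
  obtain ⟨mU, hmU⟩ := hUb
  obtain ⟨mV, hmV⟩ := hVb
  have hmU' : ∀ q, mU ≤ P.U q := fun q => hmU ⟨q, rfl⟩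
  have hmV' : ∀ r, mV ≤ P.V r := fun r => hmV ⟨r, rfl⟩
  have hUd : Differentiable ℝ P.U := hU.differentiable (by simp)
  have hVd : Differentiable ℝ P.V := hV.differentiable (by simp)
  refine Literature.Analysis.ODE.exists_solution_real_of_apriori_bound
    (fun ρ => exists_lipschitzOnWith_closedBall (contDiff_sevField Λ σ hU hV) ρ) ?_
  intro c hc T _
  refine ⟨‖x₀‖ + Real.sqrt (2 * sevEnergy P Λ σ mU mV x₀) * (T + 1),
    le_add_of_nonneg_right (by positivity), fun s hs α hα0 hα => ?_⟩
  exact norm_le_of_sevSolution P Λ σ hUd hVd hmU' hmV' hc.le hs.2 hα0 hα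

/-! ### Condition B1 -/

/-- **LLL's condition B1 holds for `C²` potentials bounded below.** If `U, V ∈ C²` (condition A2)
and `U`, `V` are bounded below, then for every finite `Λ ⊂ ℤ` and every initial configuration
`σ` the severed equations of motion (9a)–(9c) have a solution defined for all `t ∈ ℝ` starting at
`σ`, i.e. `P.CondB1` (Lanford–Lebowitz–Lieb 1977, proof of Thm 1, p. 456: the severed flows
conserve the energy `H_Λ`, so solutions "are prevented from going to infinity in finite time; they
therefore exist for all time" — there under A3–A4 via Lemma 1, here from `U, V` bounded below; the
continuation step is Teschl 2012, Cor. 2.16). This is the dischargeable content of the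
hypothesis-predicate `CondB1`, whose universal closure over `P` is false
(`InfiniteChainDynamicsBlowup.lean`, `not_forall_condB1`). [cite: LanfordLebowitzLieb1977, §2 proof of Thm 1 and §4 condition B1] -/
theorem condB1_of_bddBelow (hU : ContDiff ℝ 2 P.U) (hV : ContDiff ℝ 2 P.V)
    (hUb : BddBelow (Set.range P.U)) (hVb : BddBelow (Set.range P.V)) : P.CondB1 := by
  intro Λ σ
  obtain ⟨α, hα0, hα⟩ := exists_sevSolution P Λ σ hU hV hUb hVb (fun i => σ i)
  refine ⟨fun t => sevGlue Λ σ (α t), by simp only [hα0, sevGlue_restrict], fun i hi t => ?_,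
    fun i hi t => ?_⟩
  · have h := hasDerivAt_pi.1 (hα t) ⟨i, hi⟩
    simp only [sevField] at h
    simp_rw [sevGlue_apply_of_mem Λ σ _ hi]
    exact ⟨hasDerivAt_fst_comp h, hasDerivAt_snd_comp h⟩
  · simp [sevGlue_apply_of_not_mem Λ σ _ hi]

/-- **Condition B1 for the pinned anharmonic chain** `U(q) = ω₂ q²/2 + lam q⁴/4`,
`V(r) = r²/2 + β r⁴/4` with `ω₂, lam, β ≥ 0` (the chain `pinnedChain` of the requesting statement,
`FouriersLaw.lean`): both potentials are polynomial (so `C²`) and nonnegative, hence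
`condB1_of_bddBelow` applies. [folklore] -/
theorem condB1_pinnedChain {ω₂ lam β : ℝ} (hω : 0 ≤ ω₂) (hlam : 0 ≤ lam) (hβ : 0 ≤ β) (γ : ℝ) :
    (pinnedChain ω₂ lam β γ).CondB1 := by
  refine condB1_of_bddBelow _ ?_ ?_ ⟨0, ?_⟩ ⟨0, ?_⟩
  · show ContDiff ℝ 2 fun q : ℝ => ω₂ * q ^ 2 / 2 + lam * q ^ 4 / 4
    fun_prop
  · show ContDiff ℝ 2 fun r : ℝ => r ^ 2 / 2 + β * r ^ 4 / 4
    fun_prop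
  · rintro _ ⟨q, rfl⟩
    show (0 : ℝ) ≤ ω₂ * q ^ 2 / 2 + lam * q ^ 4 / 4
    positivity
  · rintro _ ⟨r, rfl⟩
    show (0 : ℝ) ≤ r ^ 2 / 2 + β * r ^ 4 / 4
    positivity

end OscillatorChain

end Literature.MathematicalPhysics.KineticTheory.HeatConduction

end
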